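import Literature.MathematicalPhysics.QuantumFieldTheory.Federbush1986.PeelingLinearisation
import Literature.MathematicalPhysics.QuantumFieldTheory.Federbush1986.NonAbelianDualityUNAnalytic
import Literature.MathematicalPhysics.QuantumFieldTheory.Federbush1986.NonAbelianDualityClosedSubgroup

/-!
# Federbush [F3] (5.22)–(5.24) p. 302 «The right side is the first term in a power series convergent for small fields … By the
# inverse function theorem»: the ANALYTICITY CLAUSES of the small-field linearisation PROVED for `G = U(N)` (every `N`) in every
# peelable axial gauge — the plaquette variables are a convergent power series in the bond variables with first-order term (5.22),
# and the bond variables a convergent power series in the plaquette variables with first-order term (5.23)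

statement-level skeleton of published theorems with citation tags; proofs where landed; nothing here is a claim about the Yang–Mills mass gap

SOURCE. [Federbush1987PhaseCellIII] P. Federbush, *A phase cell approach to Yang–Mills theory III. Local stability, modified
renormalization group transformation*, Commun. Math. Phys. **110** (1987) 293–309; held in the lit store as `paper:url-4700a514f365`
(journal page = PDF page + 292), p. 302 = PDF p. 10 read this session (text layer l. 21–31): *«We note at the small field limit, the
relation between A_{b_α} and A_{∂p_i}, where g_{b_α} = e^{A_{b_α}} is group element assigned to bond b_α of the r + 1 lattice (the
portion we are considering) A_{∂p_i} = Σ_α M_{iα}A_{b_α}. (5.22)  The right side is the first term in a power series convergent for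
small fields. Since the Balaban gauge provides a complete gauge specification we have in the small field region (with A_{∂p_i},
i ∈ J, a linearly independent set) A_{b_α} = Σ_{i∈J} N_{αi}A_{∂p_i} (5.23) (for bonds b_α not assigned ε by the gauge). By the inverse
function theorem we have for A_{∂p_i} small enough (depending on N), |A_{b_α} − Σ_i N_{αi}A_{∂p_i}| < cΣ|A_{∂p_i}|². (5.24)»*;
§1 p. 294 «g = e^A»; §5.3 p. 303 «Some of the constants will depend on N».  Matrix logarithm: [Balaban1985Averaging] T. Bałaban,
*Averaging operations for lattice gauge theories*, Commun. Math. Phys. **98** (1985) 17–51, (21) p. 21 «log X = Σ ((−1)^{n+1}/n)(X − 1)^n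
… Of course, both functions are analytic functions of complex matrices X» (tree: `Balaban1983to89.MatrixLog.mlog`, `analyticAt_mlog`).

CITATION HEADER (lean-in-tree rule).  lit-balaban cell (HOME `run/shared/lean/pub/lit-balaban/`), unit `lit-balaban-r17` gen 14
(reader/typer r17 = fold owner of the Federbush rows; own Phase-2 filing under the free-target protocol G.5-34(d), TAKING HOME/STATUS
2026-08-22T15:51Z), SKELETON rows **F3.Eq5.22-5.23** and **F3.Eq5.24** of `HOME/lit-balaban-r17/SKELETON-r17.md` (statement file
`LocalStability.lean`, carrier `AxialGaugeLinearisation`, r17 p239010/p243556 — UNCHANGED).  Inputs BY NAME, none edited: p26 gen 15's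
`PeelingLinearisation` (p327205/p327980: `Peeling.linearisation L hF` = THE carrier of (5.22)–(5.24) for a peeling `π` with finitely many
non-tree bonds — `Cfg = Peeling.SmallCfg` tree gauge with `|u_b| ≦ ρ/4`, `plaq u i = log g_{∂p(i)}`, `bond u α = log u_α`, `M i α = inc`,
`Nmat = Peeling.N`; `Peeling.eq522` (first order with quadratic remainder), `Peeling.sum_M_mul_N` / `Peeling.sum_N_mul_M` (`MN = 1 = NM`),
`Peeling.eq524Le` ((5.24)), `Peeling.norm_log_sub_lin_le`, `Peeling.letter_cases/dist_hol_le/norm_plaq_eq/norm_bond_eq`, `inc`,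
`sum_inc_smul`, `mem_toFinset_iff`), p26 gen 11's `PeelingObservation` (`Peeling`, `Peeling.loop`), the `U(N)` model of p12 gen 6 /
r17 gen 7 (`UN N`, `uN N`, `𝕄 N`, `expUN`, `UN.logUN` + `logUN_val`/`expUN_logUN`/`norm_val_sub_one_le`, `UN.localLog` (p32 gen 8,
`LocalLogChart`), `valL`, `UN.skewProj`/`skewProj_val_of_uN`, `inv_expUN_val`, `expUN_zero`, `SU2.wordHol_const_one`, `wordHol_congr`
(`NonAbelianDualityUNAnalytic`, `NonAbelianDualityUNScheme`, `NonAbelianDualityLocality`)), the matrix logarithm `MatrixLog.mlog` with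
`analyticAt_mlog`, `mlog_one` (b2b-balaban), `UN.hasFDerivAt_mlog_one` (r17 gen 8, `NonAbelianDualityClosedSubgroup`), and Mathlib's `NormedSpace.exp_analytic`, `hasFDerivAt_exp_zero`,
`HasFDerivAt.mul'`, `AnalyticAt.pi`, `HasStrictFDerivAt.localInverse` / `to_localInverse` and the ANALYTIC
INVERSE FUNCTION THEOREM `OpenPartialHomeomorph.analyticAt_symm`.

WHY THIS FILE (honest scope of the row before it).  p26's `PeelingLinearisation` proved (5.22) TO FIRST ORDER with an explicit quadratic
remainder, `MN = 1 = NM`, and the estimate (5.24), for every group with §1's chart data; its OWNER WORD (row F3.Eq5.22-5.23, SKELETON-r17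
v3.84) records that «the analyticity clause of (5.22) («a power series convergent for small fields») is not asserted by the tree», and
print's «By the inverse function theorem» was replaced by a hand-made induction.  This file proves BOTH analyticity clauses for the
model instance `G = U(N)` (every `N`; Frobenius data, matrix exponential and the logarithm (21)), in EVERY peelable gauge, ON p26's
carrier:

* §1–§2 the bond variables as coordinates: `extCLM hF N b` (the `𝔲(N)`-variable of bond `b`, `0` off the non-tree bonds, a continuous
  linear map of `A : B → 𝔲(N)`), the configuration `cfgUN hF A = (b ↦ e^{A_b})` («g_{b_α} = e^{A_{b_α}}», tree gauge), and for every
  word `Γ`: `(g_Γ(e^{A}))` on matrices is real-analytic in `A` (`analyticAt_wordHol_cfgUN_val`) with derivative at `A = 0` THE ABELIAN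
  WORD SUM `Σ_Γ ±A_b` (`hasFDerivAt_wordHol_cfgUN_val`: `valL ∘ wordSum extCLM Γ`) — the linear term of the iterated
  Baker–Campbell–Hausdorff series; the logarithm (21) has derivative the identity at `ε` (r17 gen 8's `UN.hasFDerivAt_mlog_one`,
  `NonAbelianDualityClosedSubgroup`, BY NAME).
* §3 **`Peeling.plaqSeries π hF N : (B → 𝔲(N)) → (B → 𝔲(N))`**, `A ↦ (log g_{∂p(i)}(e^{A}))_i` — the plaquette variables AS A FUNCTION
  of the bond variables; **`Peeling.analyticAt_plaqSeries`** (real-analytic at `0`: «a power series convergent for small fields»),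
  **`Peeling.hasFDerivAt_plaqSeries`** (its derivative at `0` is **`Peeling.Mclm`**, the continuous linear map `(MA)_i = Σ_{∂p(i)} ±A_b`),
  **`Peeling.Mclm_apply`** (`(MA)_i = Σ_α M_{iα}•A_α` with `M` = p26's carrier matrix `inc(∂p(i), α)` — «The right side [of (5.22)] is
  the first term»), `Peeling.exists_hasFPowerSeriesAt_plaqSeries` (the literal form: a `FormalMultilinearSeries` `p` with
  `HasFPowerSeriesAt plaqSeries p 0`, `p 0 = 0`, `p 1 = M`); **`Peeling.Nclm`** (`(NX)_α = Σ_i N_{αi}•X_i`, p26's `Peeling.N`),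
  `Peeling.Mclm_Nclm` / `Peeling.Nclm_Mclm` (`MN = 1 = NM`, from `Peeling.sum_M_mul_N` / `sum_N_mul_M` BY NAME) and the continuous linear
  equivalence **`Peeling.Mequiv`** («Since the Balaban gauge provides a complete gauge specification»: `M` is invertible, inverse `N`).
* §4 **`Peeling.plaq_eq_plaqSeries`**: ON THE CARRIER's configurations (`Peeling.SmallCfg`, tree gauge, `|u_b| ≦ ρ/4 = 1/400`) the carrier's
  plaquette variables ARE the values of the power series at the carrier's bond variables — `plaq u = plaqSeries (bond u)` exactly
  (tree letters `e^0 = ε`, non-tree letters `e^{log u_b} = u_b`, and `log` = the honest matrix logarithm there); `Peeling.plaq_eq_Mclm_add`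
  + `Peeling.remainder522` ((5.22) = linear term + an analytic remainder vanishing to second order at `0`).
* §5 «By the inverse function theorem»: `plaqSeries` has strict derivative `Mequiv` at `0` (`hasStrictFDerivAt_plaqSeries`), so Mathlib's
  inverse function theorem gives **`Peeling.bondSeries`** `= localInverse` with `bondSeries 0 = 0`, `bondSeries ∘ plaqSeries = id` and
  `plaqSeries ∘ bondSeries = id` near `0`, **`Peeling.hasFDerivAt_bondSeries`** (derivative `N` at `0` — (5.23) is the first-order term),
  **`Peeling.analyticAt_bondSeries`** (REAL-ANALYTIC at `0` by the analytic inverse function theorem — the bond variables are a power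
  series convergent for small fields in the plaquette variables), `Peeling.exists_hasFPowerSeriesAt_bondSeries` (literal form, `q 0 = 0`,
  `q 1 = N`); and ON THE CARRIER: **`Peeling.bond_eq_bondSeries_plaq`** (`bond u = bondSeries (plaq u)` once all `|A_b(u)| < ρ′`) and
  **`Peeling.bond_eq_bondSeries_plaq_of_plaq_lt`** (the same once all `|A_{∂p_i}(u)| < ρ″` — «for A_{∂p_i} small enough (depending on
  N)», `ρ″` through p26's rank constants `a_n`, small plaquette variables forcing small bond variables by `Peeling.norm_log_sub_lin_le`).
  The quadratic estimate (5.24) itself is p26's `Peeling.eq524Le` (untouched); here it becomes the second-order Taylor remainder of the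
  analytic function `bondSeries`.

HONEST SCOPE.  (a) MODEL INSTANCE `G = U(N)` (Bałaban's groups; [F3]'s own example is `SU(2)`): the statements need an analytic
structure on the chart, which the abstract `LocalLog G 𝔤` of the generic rows does not carry; `SU(N)` and the closed subgroups of `U(N)`
sit inside `U(N)` (their bond/plaquette variables are the same matrices) but no separate statement is made for them here.  Under the
block's rule G.1 (SKELETON-r17 v3.84) the heads of F3.Eq5.22-5.23 / F3.Eq5.24 stay `typed`; this file discharges the one printed clause of
(5.22) the tree did not assert, for `U(N)`.  (b) REAL analyticity (`AnalyticAt ℝ` on `B → 𝔲(N)`, `B` = the non-tree bonds of the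
peeling, sup norm of Frobenius norms) — print's «power series» for real fields; no complex-variable statement.  (c) The radius of
convergence and the neighbourhoods of §5 are those of Mathlib's theorems (not quantified); the QUANTITATIVE statements remain p26's
(`eq522`, `eq524Le`, explicit constants).  (d) The plaquette index set is p26's (the attached plaquettes, one per non-tree bond = print's
linearly independent `J`).  (e) Value at `0` of `plaqSeries` off the small-field region: the logarithm (21) is applied to whatever matrix
arises and projected to `𝔲(N)` by `X ↦ ½(X − X^*)` (`UN.skewProj`, the identity on honest logarithms); only its germ at `0` and its values
on the carrier (§4) are asserted to mean anything.  Definitions with bodies: `extCLM`, `cfgUN`, `Peeling.plaqSeries`, `Peeling.Mclm`,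
`Peeling.Nclm`, `Peeling.Mequiv`, `Peeling.bondSeries`; everything else is a theorem; no new named facts (`def … : Prop`), no `sorry`,
axioms standard.  OUR formalisation of a printed claim («power series convergent», «inverse function theorem») that print states
without proof; not summit progress.
-/
namespace Literature.MathematicalPhysics.QuantumFieldTheory.Federbush1986

noncomputable section

open Filter Metric Set NormedSpace
open scoped Topology Matrix.Norms.Frobenius BigOperators
open Literature.MathematicalPhysics.QuantumFieldTheory.Balaban1983to89.MatrixLog (mlog mlog_def mlog_one exp_mlog
  analyticAt_mlog)

namespace PeelingObservation

open LatticeContour SimplyConnectedBox CombGaugeObservation UN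

variable {d : ℕ} {N : ℕ}
variable {P : Set (LatticeContour.Plaq d)} {Λ T : Set (Bond d)}

/-! ## §1 The bond variables as coordinates: extension by `0` off the non-tree bonds, the configuration `e^{A}` -/

/-- The Lie-algebra variable of the bond `b` read off a family `A` indexed by the non-tree bonds (`0` on every other bond), as a
continuous linear map. [cite: Federbush1987PhaseCellIII, (5.22) p. 302] -/
def extCLM (hF : (Λ \ T).Finite) (N : ℕ) (b : Bond d) : (↥hF.toFinset → uN N) →L[ℝ] uN N :=
  if h : b ∈ hF.toFinset then ContinuousLinearMap.proj (R := ℝ) (⟨b, h⟩ : ↥hF.toFinset) else 0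

/-- `A ↦ A_b` on a non-tree bond, `0` elsewhere. [cite: Federbush1987PhaseCellIII, (5.22) p. 302] -/
theorem extCLM_apply (hF : (Λ \ T).Finite) (b : Bond d) (A : ↥hF.toFinset → uN N) :
    extCLM hF N b A = if h : b ∈ hF.toFinset then A ⟨b, h⟩ else 0 := by
  unfold extCLM
  split_ifs with h
  · rfl
  · rfl

/-- On a non-tree bond `b = b_α`: `A_b = A_α`. [cite: Federbush1987PhaseCellIII, (5.22)–(5.23) p. 302] -/
theorem extCLM_of_mem (hF : (Λ \ T).Finite) {b : Bond d} (h : b ∈ hF.toFinset) (A : ↥hF.toFinset → uN N) :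
    extCLM hF N b A = A ⟨b, h⟩ := by
  rw [extCLM_apply, dif_pos h]

/-- Off the non-tree bonds («bonds … assigned ε by the gauge»): `A_b = 0`. [cite: Federbush1987PhaseCellIII, (5.23) p. 302] -/
theorem extCLM_of_not_mem (hF : (Λ \ T).Finite) {b : Bond d} (h : b ∉ hF.toFinset) (A : ↥hF.toFinset → uN N) :
    extCLM hF N b A = 0 := by
  rw [extCLM_apply, dif_neg h]

/-- The `U(N)` configuration `b ↦ e^{A_b}` (tree gauge: `ε` off the non-tree bonds). [cite: Federbush1987PhaseCellIII, (5.22) p. 302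
«g_{b_α} = e^{A_{b_α}}»] -/
def cfgUN (hF : (Λ \ T).Finite) (A : ↥hF.toFinset → uN N) : Bond d → UN N := fun b => expUN (extCLM hF N b A)

/-- `u_b = e^{A_b}`. [cite: Federbush1987PhaseCellIII, (5.22) p. 302] -/
@[simp] theorem cfgUN_apply (hF : (Λ \ T).Finite) (A : ↥hF.toFinset → uN N) (b : Bond d) :
    cfgUN hF A b = expUN (extCLM hF N b A) := rfl

/-- The zero field is the trivial configuration `u ≡ ε`. [cite: Federbush1987PhaseCellIII, §1 (1.1) p. 294] -/
theorem cfgUN_zero (hF : (Λ \ T).Finite) : cfgUN hF (0 : ↥hF.toFinset → uN N) = fun _ => 1 := by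
  funext b
  rw [cfgUN_apply, map_zero, expUN_zero]

/-! ## §2 Word holonomies of `e^{A}` are analytic in `A`, with derivative the abelian word sum at `A = 0` -/

/-- Signed word sums of continuous linear maps evaluate letterwise. [cite: Federbush1986PhaseCellI, (1.1)–(1.2) p. 322] -/
theorem wordSum_clm_apply {E F : Type*} [NormedAddCommGroup E] [NormedSpace ℝ E] [NormedAddCommGroup F] [NormedSpace ℝ F]
    (a : Bond d → (E →L[ℝ] F)) (x : E) : ∀ w : List (Letter d), (wordSum a w) x = wordSum (fun b => a b x) w
  | [] => rfl
  | (b, s) :: w => by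
    cases s <;> simp only [wordSum, Bool.false_eq_true, ↓reduceIte, add_apply, neg_apply, wordSum_clm_apply a x w]

/-- The word holonomy `g_Γ(e^{A})` on matrices is a real-analytic function of the bond variables `A`.
[cite: Federbush1987PhaseCellIII, (5.11) p. 300, (5.22) p. 302] -/
theorem analyticAt_wordHol_cfgUN_val (hF : (Λ \ T).Finite) (A₀ : ↥hF.toFinset → uN N) :
    ∀ w : List (Letter d), AnalyticAt ℝ (fun A : ↥hF.toFinset → uN N => (wordHol (cfgUN hF A) w).val) A₀
  | [] => by
    simp only [wordHol, UN.one_val]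
    exact analyticAt_const
  | (b, s) :: w => by
    have ih := analyticAt_wordHol_cfgUN_val hF A₀ w
    have hlin : AnalyticAt ℝ (fun A : ↥hF.toFinset → uN N => (extCLM hF N b A).val) A₀ :=
      ((valL (N := N)).comp (extCLM hF N b)).analyticAt A₀
    have hexp : AnalyticAt ℝ (fun A : ↥hF.toFinset → uN N => (expUN (extCLM hF N b A)).val) A₀ := by
      simp only [expUN_val]
      exact (NormedSpace.exp_analytic _).fun_comp hlin
    have hexpn : AnalyticAt ℝ (fun A : ↥hF.toFinset → uN N => ((expUN (extCLM hF N b A))⁻¹).val) A₀ := by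
      simp only [inv_expUN_val]
      exact (NormedSpace.exp_analytic _).fun_comp hlin.fun_neg
    cases s
    · simp only [wordHol, cfgUN_apply, Bool.false_eq_true, ↓reduceIte, UN.mul_val]
      exact hexpn.fun_mul ih
    · simp only [wordHol, cfgUN_apply, ↓reduceIte, UN.mul_val]
      exact hexp.fun_mul ih

/-- At `A = 0` every word holonomy is `ε`. [cite: Federbush1987PhaseCellIII, (5.11) p. 300] -/
theorem wordHol_cfgUN_zero (hF : (Λ \ T).Finite) (w : List (Letter d)) :
    wordHol (cfgUN hF (0 : ↥hF.toFinset → uN N)) w = 1 := by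
  rw [cfgUN_zero, SU2.wordHol_const_one]

/-- The derivative of `e^{X}` at `0` along the coordinate `A ↦ A_b`: `A ↦ A_b`. [cite: Federbush1987PhaseCellIII, (1.7)–(1.8) p. 295] -/
theorem hasFDerivAt_exp_extCLM (hF : (Λ \ T).Finite) (b : Bond d) :
    HasFDerivAt (fun A : ↥hF.toFinset → uN N => exp ((extCLM hF N b A).val))
      ((valL (N := N)).comp (extCLM hF N b)) 0 := by
  have hlin : HasFDerivAt (fun A : ↥hF.toFinset → uN N => (extCLM hF N b A).val)
      ((valL (N := N)).comp (extCLM hF N b)) 0 :=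
    ((valL (N := N)).comp (extCLM hF N b)).hasFDerivAt
  have hexp : HasFDerivAt (exp : 𝕄 N → 𝕄 N) (1 : 𝕄 N →L[ℝ] 𝕄 N) ((extCLM hF N b (0 : ↥hF.toFinset → uN N)).val) := by
    rw [map_zero, uN.zero_val]
    exact hasFDerivAt_exp_zero
  refine (hexp.comp (0 : ↥hF.toFinset → uN N) hlin).congr_fderiv ?_
  ext1 v
  rfl

/-- … and along `A ↦ −A_b` (the reversed letter `e^{−A_b} = (e^{A_b})⁻¹`). [cite: Federbush1987PhaseCellIII, (1.7)–(1.8) p. 295] -/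
theorem hasFDerivAt_exp_neg_extCLM (hF : (Λ \ T).Finite) (b : Bond d) :
    HasFDerivAt (fun A : ↥hF.toFinset → uN N => exp (-(extCLM hF N b A).val))
      (-((valL (N := N)).comp (extCLM hF N b))) 0 := by
  have hlin : HasFDerivAt (fun A : ↥hF.toFinset → uN N => -(extCLM hF N b A).val)
      (-((valL (N := N)).comp (extCLM hF N b))) 0 :=
    ((valL (N := N)).comp (extCLM hF N b)).hasFDerivAt.neg
  have hexp : HasFDerivAt (exp : 𝕄 N → 𝕄 N) (1 : 𝕄 N →L[ℝ] 𝕄 N) (-(extCLM hF N b (0 : ↥hF.toFinset → uN N)).val) := by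
    rw [map_zero, uN.zero_val, neg_zero]
    exact hasFDerivAt_exp_zero
  refine (hexp.comp (0 : ↥hF.toFinset → uN N) hlin).congr_fderiv ?_
  ext1 v
  rfl

/-- **The derivative of the word holonomy at the trivial configuration is the abelian word sum**: `D(g_Γ(e^{A}))(0)·A = Σ_{Γ} ±A_b`
(the linear term of the iterated Baker–Campbell–Hausdorff series). [cite: Federbush1987PhaseCellIII, (5.11) p. 300, (5.22) p. 302;
Federbush1986PhaseCellI, (1.1)–(1.2) p. 322] -/
theorem hasFDerivAt_wordHol_cfgUN_val (hF : (Λ \ T).Finite) :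
    ∀ w : List (Letter d), HasFDerivAt (fun A : ↥hF.toFinset → uN N => (wordHol (cfgUN hF A) w).val)
      ((valL (N := N)).comp (wordSum (fun b => extCLM hF N b) w)) 0
  | [] => by
    simp only [wordHol, UN.one_val, wordSum, ContinuousLinearMap.comp_zero]
    exact hasFDerivAt_const _ _
  | (b, s) :: w => by
    have ih := hasFDerivAt_wordHol_cfgUN_val hF w
    have h1 : (wordHol (cfgUN hF (0 : ↥hF.toFinset → uN N)) w).val = 1 := by rw [wordHol_cfgUN_zero, UN.one_val]
    cases s
    · -- reversed letter
      have hl := hasFDerivAt_exp_neg_extCLM (N := N) hF b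
      have hprod := hl.mul' ih
      have hl0 : exp (-(extCLM hF N b (0 : ↥hF.toFinset → uN N)).val) = 1 := by
        rw [map_zero, uN.zero_val, neg_zero, exp_zero]
      rw [hl0, h1, one_smul, MulOpposite.op_one, one_smul] at hprod
      have heq : (fun A : ↥hF.toFinset → uN N => (wordHol (cfgUN hF A) ((b, false) :: w)).val) =
          (fun A => exp (-(extCLM hF N b A).val)) * fun A => (wordHol (cfgUN hF A) w).val := by
        funext A
        simp only [wordHol, cfgUN_apply, Bool.false_eq_true, ↓reduceIte, UN.mul_val, inv_expUN_val, Pi.mul_apply]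
      rw [heq]
      refine hprod.congr_fderiv ?_
      have hD : wordSum (fun b => extCLM hF N b) ((b, false) :: w) = -(extCLM hF N b) + wordSum (fun b => extCLM hF N b) w :=
        rfl
      rw [hD, ContinuousLinearMap.comp_add, ContinuousLinearMap.comp_neg, add_comm]
      rfl
    · have hl := hasFDerivAt_exp_extCLM (N := N) hF b
      have hprod := hl.mul' ih
      have hl0 : exp ((extCLM hF N b (0 : ↥hF.toFinset → uN N)).val) = 1 := by
        rw [map_zero, uN.zero_val, exp_zero]
      rw [hl0, h1, one_smul, MulOpposite.op_one, one_smul] at hprod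
      have heq : (fun A : ↥hF.toFinset → uN N => (wordHol (cfgUN hF A) ((b, true) :: w)).val) =
          (fun A => exp ((extCLM hF N b A).val)) * fun A => (wordHol (cfgUN hF A) w).val := by
        funext A
        simp only [wordHol, cfgUN_apply, ↓reduceIte, UN.mul_val, expUN_val, Pi.mul_apply]
      rw [heq]
      refine hprod.congr_fderiv ?_
      have hD : wordSum (fun b => extCLM hF N b) ((b, true) :: w) = extCLM hF N b + wordSum (fun b => extCLM hF N b) w := rfl
      rw [hD, ContinuousLinearMap.comp_add, add_comm]
      rfl

/-! ## §3 «A_{∂p_i} = Σ_α M_{iα}A_{b_α} (5.22). The right side is the first term in a power series convergent for small fields»: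
the plaquette variables of a peeling as an analytic map of the bond variables, with derivative `M` at `0` -/

section PlaqSeries

variable (π : Peeling P Λ T) (hF : (Λ \ T).Finite) (N : ℕ)

/-- **The plaquette variables as a function of the Lie-algebra bond variables** — the analytic extension of the carrier's
`plaq`: `A ↦ (log g_{∂p(i)}(e^{A}))_i`, the matrix logarithm (21) of the attached plaquette holonomies of the configuration
`e^{A}` (projected back to `𝔲(N)` by `X ↦ ½(X − X^*)`, the identity on the honest logarithms). [cite: Federbush1987PhaseCellIII,
(5.22) p. 302] -/
def Peeling.plaqSeries (A : ↥hF.toFinset → uN N) : ↥hF.toFinset → uN N :=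
  fun i => skewProj (mlog (wordHol (cfgUN hF A) (π.loop i.1)).val)

/-- **The matrix `M_{iα}` of (5.22) as a continuous linear map** on the bond variables: `(MA)_i = Σ_{letters of ∂p(i)} ±A_b`
(= `Σ_α inc(∂p(i), α)•A_α`, `Peeling.Mclm_apply`). [cite: Federbush1987PhaseCellIII, (5.22) p. 302] -/
def Peeling.Mclm : (↥hF.toFinset → uN N) →L[ℝ] (↥hF.toFinset → uN N) :=
  ContinuousLinearMap.pi fun i => wordSum (fun b => extCLM hF N b) (π.loop i.1)

/-- **The matrix `N_{αi}` of (5.23) as a continuous linear map** on the plaquette variables: `(NA)_α = Σ_i N_{αi}•A_i` (p26's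
abelian solution `Peeling.N` of the peeling). [cite: Federbush1987PhaseCellIII, (5.23) p. 302] -/
def Peeling.Nclm : (↥hF.toFinset → uN N) →L[ℝ] (↥hF.toFinset → uN N) :=
  ContinuousLinearMap.pi fun α => ∑ i : ↥hF.toFinset, π.N α.1 i.1 • ContinuousLinearMap.proj (R := ℝ) i

variable {π hF N}

/-- Unfolding `plaqSeries`. [cite: Federbush1987PhaseCellIII, (5.22) p. 302] -/
theorem Peeling.plaqSeries_apply (A : ↥hF.toFinset → uN N) (i : ↥hF.toFinset) :
    π.plaqSeries hF N A i = skewProj (mlog (wordHol (cfgUN hF A) (π.loop i.1)).val) := rfl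

/-- At `A = 0` all plaquette variables vanish. [cite: Federbush1987PhaseCellIII, (5.22) p. 302] -/
theorem Peeling.plaqSeries_zero : π.plaqSeries hF N 0 = 0 := by
  funext i
  rw [Peeling.plaqSeries_apply, wordHol_cfgUN_zero, UN.one_val, mlog_one, map_zero, Pi.zero_apply]

/-- **(5.22) «… a power series convergent for small fields»: the plaquette variables are a real-analytic function of the bond
variables at the trivial configuration** (`U(N)`, every peeling). [cite: Federbush1987PhaseCellIII, (5.22) p. 302] -/
theorem Peeling.analyticAt_plaqSeries : AnalyticAt ℝ (π.plaqSeries hF N) 0 := by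
  refine AnalyticAt.pi fun i => ?_
  have hlog : AnalyticAt ℝ (mlog : 𝕄 N → 𝕄 N) 1 :=
    (analyticAt_mlog (X := (1 : 𝕄 N)) (by rw [sub_self, norm_zero]; norm_num)).restrictScalars
  refine ((skewProj (N := N)).analyticAt _).fun_comp (hlog.fun_comp_of_eq (analyticAt_wordHol_cfgUN_val hF 0 _) ?_)
  rw [wordHol_cfgUN_zero, UN.one_val]

/-- **«The right side [of (5.22)] is the first term» of that power series: the derivative of the plaquette variables at `0`
is `M`.** [cite: Federbush1987PhaseCellIII, (5.22) p. 302] -/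
theorem Peeling.hasFDerivAt_plaqSeries : HasFDerivAt (π.plaqSeries hF N) (π.Mclm hF N) 0 := by
  refine hasFDerivAt_pi.2 fun i => ?_
  have hw := hasFDerivAt_wordHol_cfgUN_val (N := N) hF (π.loop i.1)
  have hlog : HasFDerivAt (mlog : 𝕄 N → 𝕄 N) (ContinuousLinearMap.id ℝ (𝕄 N))
      ((wordHol (cfgUN hF (0 : ↥hF.toFinset → uN N)) (π.loop i.1)).val) := by
    rw [wordHol_cfgUN_zero, UN.one_val]
    exact UN.hasFDerivAt_mlog_one
  have h := ((skewProj (N := N)).hasFDerivAt).comp (0 : ↥hF.toFinset → uN N) (hlog.comp (0 : ↥hF.toFinset → uN N) hw)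
  refine h.congr_fderiv ?_
  ext1 A
  show skewProj ((valL (N := N)) (wordSum (fun b => extCLM hF N b) (π.loop i.1) A)) = _
  rw [valL_apply, skewProj_val_of_uN]

/-- The literal power-series form of (5.22): the plaquette variables are the sum of a convergent power series in the bond
variables whose term of degree one is `A ↦ MA`. [cite: Federbush1987PhaseCellIII, (5.22) p. 302] -/
theorem Peeling.exists_hasFPowerSeriesAt_plaqSeries :
    ∃ p : FormalMultilinearSeries ℝ (↥hF.toFinset → uN N) (↥hF.toFinset → uN N),
      HasFPowerSeriesAt (π.plaqSeries hF N) p 0 ∧ (p 0 = 0) ∧ ∀ A, p 1 (fun _ => A) = π.Mclm hF N A := by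
  obtain ⟨p, hp⟩ := π.analyticAt_plaqSeries (hF := hF) (N := N)
  refine ⟨p, hp, ?_, fun A => ?_⟩
  · have h0 := hp.coeff_zero (fun _ => (0 : ↥hF.toFinset → uN N))
    rw [Peeling.plaqSeries_zero] at h0
    ext v i
    rw [Subsingleton.elim v (fun _ => 0), h0]
    rfl
  · have hd := (π.hasFDerivAt_plaqSeries (hF := hF) (N := N)).unique hp.hasFDerivAt
    have hs : (Fin.snoc (0 : Fin 0 → (↥hF.toFinset → uN N)) A : Fin 1 → (↥hF.toFinset → uN N)) = fun _ => A := by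
      funext j
      rw [Fin.fin_one_eq_zero j]
      exact Fin.snoc_last (α := fun _ => (↥hF.toFinset → uN N)) (p := 0) (x := A)
    rw [hd, continuousMultilinearCurryFin1_apply, hs]

/-- `(MA)_i = Σ_α inc(∂p(i), α) • A_α` — the continuous linear map `Mclm` IS the matrix `M_{iα}` of p26's carrier.
[cite: Federbush1987PhaseCellIII, (5.22) p. 302] -/
theorem Peeling.Mclm_apply (A : ↥hF.toFinset → uN N) (i : ↥hF.toFinset) :
    π.Mclm hF N A i = ∑ α, (π.linearisation (UN.localLog (N := N)) hF).M i α • A α := by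
  classical
  show wordSum (fun b => extCLM hF N b) (π.loop i.1) A = ∑ α : ↥hF.toFinset, inc (π.loop i.1) α.1 • A α
  rw [wordSum_clm_apply]
  set x : Bond d → uN N := fun b => if h : b ∈ hF.toFinset then A ⟨b, h⟩ else 0 with hx
  have hsum : ∑ α : ↥hF.toFinset, inc (π.loop i.1) α.1 • A α = ∑ α ∈ hF.toFinset, inc (π.loop i.1) α • x α := by
    rw [← Finset.sum_attach hF.toFinset (fun α => inc (π.loop i.1) α • x α)]
    refine Finset.sum_congr rfl fun α _ => ?_
    rw [hx]
    simp only [dif_pos α.2]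
  rw [hsum, sum_inc_smul]
  refine wordSum_congr _ fun l _ => ?_
  rw [extCLM_apply]
  by_cases h : l.1 ∈ hF.toFinset
  · simp only [if_pos h, hx, dif_pos h]
  · simp only [if_neg h, hx, dif_neg h]

/-- `(NA)_α = Σ_i N_{αi} • A_i`. [cite: Federbush1987PhaseCellIII, (5.23) p. 302] -/
theorem Peeling.Nclm_apply (A : ↥hF.toFinset → uN N) (α : ↥hF.toFinset) :
    π.Nclm hF N A α = ∑ i, (π.linearisation (UN.localLog (N := N)) hF).Nmat α i • A i := by
  show (∑ i : ↥hF.toFinset, π.N α.1 i.1 • ContinuousLinearMap.proj (R := ℝ) i) A = ∑ i : ↥hF.toFinset, π.N α.1 i.1 • A i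
  rw [sum_apply]
  rfl

/-- `MN = 1`: (5.23) inverts (5.22) (p26's `Peeling.sum_M_mul_N`). [cite: Federbush1987PhaseCellIII, (5.22)–(5.23) p. 302] -/
theorem Peeling.Mclm_Nclm (A : ↥hF.toFinset → uN N) : π.Mclm hF N (π.Nclm hF N A) = A := by
  funext i
  rw [Peeling.Mclm_apply]
  simp_rw [Peeling.Nclm_apply, Finset.smul_sum, smul_smul]
  rw [Finset.sum_comm]
  simp_rw [← Finset.sum_smul]
  have h : ∀ j : ↥hF.toFinset, (∑ α, (π.linearisation (UN.localLog (N := N)) hF).M i α * (π.linearisation (UN.localLog (N := N)) hF).Nmat α j) • A j =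
      if i = j then A j else 0 := fun j => by
    rw [π.sum_M_mul_N (UN.localLog (N := N)) hF i j]
    by_cases hij : i = j
    · rw [if_pos (congrArg Subtype.val hij), if_pos hij, one_smul]
    · rw [if_neg (fun e => hij (Subtype.ext e)), if_neg hij, zero_smul]
  simp_rw [h]
  exact (Finset.sum_eq_single i (fun j _ hj => if_neg (Ne.symm hj)) (fun hi => absurd (Finset.mem_univ i) hi)).trans
    (if_pos rfl)

/-- `NM = 1` (p26's `Peeling.sum_N_mul_M`). [cite: Federbush1987PhaseCellIII, (5.22)–(5.23) p. 302] -/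
theorem Peeling.Nclm_Mclm (A : ↥hF.toFinset → uN N) : π.Nclm hF N (π.Mclm hF N A) = A := by
  funext α
  rw [Peeling.Nclm_apply]
  simp_rw [Peeling.Mclm_apply, Finset.smul_sum, smul_smul]
  rw [Finset.sum_comm]
  simp_rw [← Finset.sum_smul]
  have h : ∀ β : ↥hF.toFinset, (∑ i, (π.linearisation (UN.localLog (N := N)) hF).Nmat α i * (π.linearisation (UN.localLog (N := N)) hF).M i β) • A β =
      if α = β then A β else 0 := fun β => by
    rw [π.sum_N_mul_M (UN.localLog (N := N)) hF α β]
    by_cases hab : α = β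
    · rw [if_pos (congrArg Subtype.val hab), if_pos hab, one_smul]
    · rw [if_neg (fun e => hab (Subtype.ext e)), if_neg hab, zero_smul]
  simp_rw [h]
  exact (Finset.sum_eq_single α (fun β _ hβ => if_neg (Ne.symm hβ)) (fun hα => absurd (Finset.mem_univ α) hα)).trans
    (if_pos rfl)

variable (π hF N) in
/-- **`M` is invertible with inverse `N`** («Since the Balaban gauge provides a complete gauge specification»), as a continuous
linear equivalence. [cite: Federbush1987PhaseCellIII, (5.23) p. 302] -/
def Peeling.Mequiv : (↥hF.toFinset → uN N) ≃L[ℝ] (↥hF.toFinset → uN N) :=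
  ContinuousLinearEquiv.equivOfInverse (π.Mclm hF N) (π.Nclm hF N) (π.Nclm_Mclm) (π.Mclm_Nclm)

/-- `Mequiv` is `M`. [cite: Federbush1987PhaseCellIII, (5.22) p. 302] -/
@[simp] theorem Peeling.coe_Mequiv : (π.Mequiv hF N : (↥hF.toFinset → uN N) →L[ℝ] (↥hF.toFinset → uN N)) = π.Mclm hF N := rfl

/-- `Mequiv⁻¹` is `N`. [cite: Federbush1987PhaseCellIII, (5.23) p. 302] -/
@[simp] theorem Peeling.coe_Mequiv_symm :
    ((π.Mequiv hF N).symm : (↥hF.toFinset → uN N) →L[ℝ] (↥hF.toFinset → uN N)) = π.Nclm hF N := rfl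

end PlaqSeries

/-! ## §4 The power series IS the carrier's plaquette map on the small-field configurations -/

section Carrier

variable (π : Peeling P Λ T) (hF : (Λ \ T).Finite) (N : ℕ)

/-- The configuration `e^{A(u)}` rebuilt from the bond variables `A(u)_α = log u_α` of a small-field tree-gauge configuration `u`
agrees with `u` on every letter of an attached plaquette boundary (tree letters: `ε = e^0`; non-tree letters: `e^{log u_b} = u_b`).
[cite: Federbush1987PhaseCellIII, (5.22) p. 302 «g_{b_α} = e^{A_{b_α}}»; §5.3 2)–3) p. 303] -/
theorem Peeling.cfgUN_bond_eq (u : (π.linearisation (UN.localLog (N := N)) hF).Cfg) {i : Bond d} (hi : i ∈ Λ) (hiT : i ∉ T)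
    {l : Letter d} (hl : l ∈ π.loop i) :
    cfgUN hF ((π.linearisation (UN.localLog (N := N)) hF).bond u) l.1 = u.1 l.1 := by
  rcases π.letter_cases hi hiT hl with h | ⟨h1, h2⟩
  · have hnot : l.1 ∉ hF.toFinset := fun hm => ((mem_toFinset_iff hF).1 hm).2 h
    rw [cfgUN_apply, extCLM_of_not_mem hF hnot, expUN_zero, u.2.1 _ h]
  · have hmem : l.1 ∈ hF.toFinset := (mem_toFinset_iff hF).2 ⟨h1, h2⟩
    rw [cfgUN_apply, extCLM_of_mem hF hmem]
    show expUN (logUN (u.1 l.1)) = u.1 l.1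
    have hρ : (UN.localLog (N := N)).ρ / 4 = 1 / 400 := by rw [UN.localLog_ρ]; norm_num
    have hd : dist 1 (u.1 l.1) ≤ 1 / 400 := (u.2.2 _ h1 h2).trans hρ.le
    exact expUN_logUN ((norm_val_sub_one_le _).trans_lt (by linarith))

/-- **On the small-field tree-gauge configurations the carrier's plaquette variables ARE the values of the power series at the
carrier's bond variables**: `A_{∂p_i}(u) = plaqSeries(A_b(u))_i` — so (5.22) with its higher-order terms is an identity between
the typed objects of row F3.Eq5.22-5.23, not only between stand-ins. [cite: Federbush1987PhaseCellIII, (5.22) p. 302] -/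
theorem Peeling.plaq_eq_plaqSeries (u : (π.linearisation (UN.localLog (N := N)) hF).Cfg) :
    (π.linearisation (UN.localLog (N := N)) hF).plaq u =
      π.plaqSeries hF N ((π.linearisation (UN.localLog (N := N)) hF).bond u) := by
  funext i
  obtain ⟨hiΛ, hiT⟩ := (mem_toFinset_iff hF).1 i.2
  have hw : wordHol (cfgUN hF ((π.linearisation (UN.localLog (N := N)) hF).bond u)) (π.loop i.1) =
      wordHol u.1 (π.loop i.1) :=
    wordHol_congr _ fun l hl => π.cfgUN_bond_eq hF N u hiΛ hiT hl
  rw [Peeling.plaqSeries_apply, hw]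
  show logUN (wordHol u.1 (π.loop i.1)) = skewProj (mlog (wordHol u.1 (π.loop i.1)).val)
  have hρ : (UN.localLog (N := N)).ρ = 1 / 100 := UN.localLog_ρ
  have hd : dist 1 (wordHol u.1 (π.loop i.1)) ≤ 1 / 100 := (π.dist_hol_le u hiΛ hiT).trans hρ.le
  have hlt : ‖(wordHol u.1 (π.loop i.1)).val - 1‖ < 1 / 4 := (norm_val_sub_one_le _).trans_lt (by linarith)
  rw [← logUN_val hlt, skewProj_val_of_uN]

/-- Hence (5.22) with remainder, for the typed carrier, READ OFF THE POWER SERIES: `A_{∂p}(u) = M·A_b(u) + (plaqSeries − M)(A_b(u))`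
where `plaqSeries − M` is analytic at `0` with vanishing value and derivative (p26's `Peeling.eq522` quantifies the remainder as
`≦ (4 + 128Kρ)Σ|A_b|²`). [cite: Federbush1987PhaseCellIII, (5.22) p. 302] -/
theorem Peeling.plaq_eq_Mclm_add (u : (π.linearisation (UN.localLog (N := N)) hF).Cfg) :
    (π.linearisation (UN.localLog (N := N)) hF).plaq u =
      π.Mclm hF N ((π.linearisation (UN.localLog (N := N)) hF).bond u) +
        (π.plaqSeries hF N ((π.linearisation (UN.localLog (N := N)) hF).bond u) -
          π.Mclm hF N ((π.linearisation (UN.localLog (N := N)) hF).bond u)) := by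
  rw [π.plaq_eq_plaqSeries hF N u, add_sub_cancel]

/-- … the remainder `plaqSeries − M` being analytic at `0`, zero at `0`, with zero derivative at `0` (all its power-series terms have
degree `≥ 2`). [cite: Federbush1987PhaseCellIII, (5.22) p. 302] -/
theorem Peeling.remainder522 :
    AnalyticAt ℝ (fun A => π.plaqSeries hF N A - π.Mclm hF N A) 0 ∧ (π.plaqSeries hF N 0 - π.Mclm hF N 0 = 0) ∧
      HasFDerivAt (fun A => π.plaqSeries hF N A - π.Mclm hF N A)
        (0 : (↥hF.toFinset → uN N) →L[ℝ] (↥hF.toFinset → uN N)) 0 := by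
  refine ⟨π.analyticAt_plaqSeries.fun_sub ((π.Mclm hF N).analyticAt 0), ?_, ?_⟩
  · rw [Peeling.plaqSeries_zero, map_zero, sub_zero]
  · have h := (π.hasFDerivAt_plaqSeries (hF := hF) (N := N)).fun_sub (π.Mclm hF N).hasFDerivAt
    rwa [sub_self] at h

end Carrier

/-! ## §5 «By the inverse function theorem»: the bond variables as a convergent power series in the plaquette variables, first
term (5.23) -/

section Inverse

variable (π : Peeling P Λ T) (hF : (Λ \ T).Finite) (N : ℕ)

/-- The plaquette map has STRICT derivative the invertible `M` at `0` (analytic maps are strictly differentiable).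
[cite: Federbush1987PhaseCellIII, (5.22)–(5.24) p. 302] -/
theorem Peeling.hasStrictFDerivAt_plaqSeries :
    HasStrictFDerivAt (π.plaqSeries hF N) (π.Mequiv hF N : (↥hF.toFinset → uN N) →L[ℝ] (↥hF.toFinset → uN N)) 0 := by
  have h := (π.analyticAt_plaqSeries (hF := hF) (N := N)).hasStrictFDerivAt
  rwa [(π.hasFDerivAt_plaqSeries (hF := hF) (N := N)).fderiv] at h

/-- **The bond variables as a function of the plaquette variables** — the local inverse of `plaqSeries` at `0` given by the
inverse function theorem («By the inverse function theorem we have for A_{∂p_i} small enough …»). [cite: Federbush1987PhaseCellIII,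
(5.23)–(5.24) p. 302] -/
def Peeling.bondSeries : (↥hF.toFinset → uN N) → (↥hF.toFinset → uN N) :=
  (π.hasStrictFDerivAt_plaqSeries hF N).localInverse (π.plaqSeries hF N) (π.Mequiv hF N) 0

/-- `bondSeries 0 = 0`. [cite: Federbush1987PhaseCellIII, (5.23) p. 302] -/
theorem Peeling.bondSeries_zero : π.bondSeries hF N 0 = 0 := by
  have h := (π.hasStrictFDerivAt_plaqSeries hF N).localInverse_apply_image
  rwa [Peeling.plaqSeries_zero] at h

/-- `bondSeries ∘ plaqSeries = id` near `0`: the bond variables are recovered from the plaquette variables («Since the Balaban gauge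
provides a complete gauge specification»). [cite: Federbush1987PhaseCellIII, (5.23) p. 302; §5.3 2) Observation p. 303] -/
theorem Peeling.bondSeries_plaqSeries : ∀ᶠ A in 𝓝 (0 : ↥hF.toFinset → uN N), π.bondSeries hF N (π.plaqSeries hF N A) = A :=
  (π.hasStrictFDerivAt_plaqSeries hF N).eventually_left_inverse

/-- `plaqSeries ∘ bondSeries = id` near `0`. [cite: Federbush1987PhaseCellIII, (5.22)–(5.23) p. 302] -/
theorem Peeling.plaqSeries_bondSeries : ∀ᶠ X in 𝓝 (0 : ↥hF.toFinset → uN N), π.plaqSeries hF N (π.bondSeries hF N X) = X := by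
  have h := (π.hasStrictFDerivAt_plaqSeries hF N).eventually_right_inverse
  rwa [Peeling.plaqSeries_zero] at h

/-- **(5.23) is the first-order term: the derivative of `bondSeries` at `0` is `N`.** [cite: Federbush1987PhaseCellIII, (5.23)–(5.24)
p. 302] -/
theorem Peeling.hasFDerivAt_bondSeries : HasFDerivAt (π.bondSeries hF N) (π.Nclm hF N) 0 := by
  have h := (π.hasStrictFDerivAt_plaqSeries hF N).to_localInverse
  rw [Peeling.plaqSeries_zero] at h
  exact h.hasFDerivAt

/-- **«By the inverse function theorem»: the bond variables are a REAL-ANALYTIC function of the plaquette variables at `0`** — a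
power series convergent for small fields (Mathlib's analytic inverse function theorem `OpenPartialHomeomorph.analyticAt_symm`).
[cite: Federbush1987PhaseCellIII, (5.23)–(5.24) p. 302] -/
theorem Peeling.analyticAt_bondSeries : AnalyticAt ℝ (π.bondSeries hF N) 0 := by
  have hf := π.hasStrictFDerivAt_plaqSeries hF N
  have h0 : (0 : ↥hF.toFinset → uN N) ∈ (hf.toOpenPartialHomeomorph (π.plaqSeries hF N)).target := by
    have h := hf.image_mem_toOpenPartialHomeomorph_target
    rwa [Peeling.plaqSeries_zero] at h
  have hsymm : (hf.toOpenPartialHomeomorph (π.plaqSeries hF N)).symm 0 = 0 := π.bondSeries_zero hF N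
  refine (hf.toOpenPartialHomeomorph (π.plaqSeries hF N)).analyticAt_symm (i := π.Mequiv hF N) h0 ?_ ?_
  · rw [hsymm]
    exact π.analyticAt_plaqSeries
  · rw [hsymm]
    exact (π.hasFDerivAt_plaqSeries (hF := hF) (N := N)).fderiv

/-- The literal power-series form of (5.23)–(5.24): the bond variables are the sum of a convergent power series in the plaquette
variables with no constant term and term of degree one `X ↦ NX`. [cite: Federbush1987PhaseCellIII, (5.23)–(5.24) p. 302] -/
theorem Peeling.exists_hasFPowerSeriesAt_bondSeries :
    ∃ q : FormalMultilinearSeries ℝ (↥hF.toFinset → uN N) (↥hF.toFinset → uN N),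
      HasFPowerSeriesAt (π.bondSeries hF N) q 0 ∧ (q 0 = 0) ∧ ∀ X, q 1 (fun _ => X) = π.Nclm hF N X := by
  obtain ⟨q, hq⟩ := π.analyticAt_bondSeries hF N
  refine ⟨q, hq, ?_, fun X => ?_⟩
  · have h0 := hq.coeff_zero (fun _ => (0 : ↥hF.toFinset → uN N))
    rw [Peeling.bondSeries_zero] at h0
    ext v i
    rw [Subsingleton.elim v (fun _ => 0), h0]
    rfl
  · have hd := (π.hasFDerivAt_bondSeries hF N).unique hq.hasFDerivAt
    have hs : (Fin.snoc (0 : Fin 0 → (↥hF.toFinset → uN N)) X : Fin 1 → (↥hF.toFinset → uN N)) = fun _ => X := by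
      funext j
      rw [Fin.fin_one_eq_zero j]
      exact Fin.snoc_last (α := fun _ => (↥hF.toFinset → uN N)) (p := 0) (x := X)
    rw [hd, continuousMultilinearCurryFin1_apply, hs]

/-- **The carrier's bond variables ARE the values of the inverse power series at the carrier's plaquette variables, for small
bond variables**: there is `ρ′ > 0` such that every small-field tree-gauge configuration `u` with all `|A_b(u)| < ρ′` has
`A_b(u) = bondSeries(A_{∂p}(u))` — (5.23) with all its higher-order corrections; (5.24) is the quadratic Taylor remainder of this
analytic function (p26's `Peeling.eq524Le` gives it with explicit constants). [cite: Federbush1987PhaseCellIII, (5.23)–(5.24) p. 302] -/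
theorem Peeling.bond_eq_bondSeries_plaq :
    ∃ ρ' > (0 : ℝ), ∀ u : (π.linearisation (UN.localLog (N := N)) hF).Cfg,
      (∀ α, ‖(π.linearisation (UN.localLog (N := N)) hF).bond u α‖ < ρ') →
        (π.linearisation (UN.localLog (N := N)) hF).bond u =
          π.bondSeries hF N ((π.linearisation (UN.localLog (N := N)) hF).plaq u) := by
  obtain ⟨ε, hε, h⟩ := Metric.eventually_nhds_iff.mp (π.bondSeries_plaqSeries hF N)
  refine ⟨ε, hε, fun u hu => ?_⟩
  rw [π.plaq_eq_plaqSeries hF N u]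
  refine (h ?_).symm
  rw [dist_zero_right]
  exact (pi_norm_lt_iff hε).mpr hu

/-- **… and for small PLAQUETTE variables, as print has it** («By the inverse function theorem we have for A_{∂p_i} small enough
(depending on N) …»): there is `ρ″ > 0` («depending on N»: on the peeling, through p26's rank constants `a_n`) such that every
small-field tree-gauge configuration with all `|A_{∂p_i}(u)| < ρ″` has `A_b(u) = bondSeries(A_{∂p}(u))` — small plaquette variables
force small bond variables by p26's `Peeling.norm_log_sub_lin_le`. [cite: Federbush1987PhaseCellIII, (5.23)–(5.24) p. 302; §5.3
p. 303 «Some of the constants will depend on N»] -/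
theorem Peeling.bond_eq_bondSeries_plaq_of_plaq_lt :
    ∃ ρ'' > (0 : ℝ), ∀ u : (π.linearisation (UN.localLog (N := N)) hF).Cfg,
      (∀ i, ‖(π.linearisation (UN.localLog (N := N)) hF).plaq u i‖ < ρ'') →
        (π.linearisation (UN.localLog (N := N)) hF).bond u =
          π.bondSeries hF N ((π.linearisation (UN.localLog (N := N)) hF).plaq u) := by
  classical
  obtain ⟨ρ', hρ', hbond⟩ := π.bond_eq_bondSeries_plaq hF N
  set Fs := hF.toFinset with hFs_def
  have hFs : ∀ b, b ∈ Fs ↔ b ∈ Λ ∧ b ∉ T := fun b => mem_toFinset_iff hF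
  set n : ℕ := Fs.sup π.rank + 1 with hn
  have han : 1 ≤ aC n := one_le_aC_succ _
  have han0 : 0 < aC n := lt_of_lt_of_le one_pos han
  set L : LocalLog (UN N) (uN N) := UN.localLog (N := N) with hL
  have hρ : 0 < L.ρ := L.ρ_pos
  refine ⟨min (L.ρ / aC n) (ρ' / (2 * aC n)), lt_min (div_pos hρ han0) (div_pos hρ' (by positivity)), fun u hu => ?_⟩
  refine hbond u fun α => ?_
  obtain ⟨hαΛ, hαT⟩ := (hFs α.1).1 α.2
  -- the plaquette sizes are bounded by `S = min (ρ/a_n) (ρ′/(2a_n))`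
  set S : ℝ := min (L.ρ / aC n) (ρ' / (2 * aC n)) with hS
  have hS0 : 0 ≤ S := (lt_min (div_pos hρ han0) (div_pos hρ' (by positivity))).le
  have hSi : ∀ i ∈ Fs, dist 1 (wordHol u.1 (π.loop i)) ≤ S := fun i hi => by
    rw [← π.norm_plaq_eq u ((hFs i).1 hi).1 ((hFs i).1 hi).2]
    exact (hu ⟨i, hi⟩).le
  have hnS : aC n * S ≤ L.ρ := by
    calc aC n * S ≤ aC n * (L.ρ / aC n) := mul_le_mul_of_nonneg_left (min_le_left _ _) han0.le
      _ = L.ρ := mul_div_cancel₀ _ han0.ne'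
  have hrank : π.rank α.1 < n := Nat.lt_succ_of_le (Finset.le_sup (f := π.rank) α.2)
  obtain ⟨hdist, -⟩ := π.norm_log_sub_lin_le L Fs hFs u.1 u.2.1 hS0 hSi n hnS α.1 hαΛ hrank
  show ‖L.log (u.1 α.1)‖ < ρ'
  rw [π.norm_bond_eq u hαΛ hαT]
  calc dist 1 (u.1 α.1) ≤ aC n * S := hdist
    _ ≤ aC n * (ρ' / (2 * aC n)) := mul_le_mul_of_nonneg_left (min_le_right _ _) han0.le
    _ = ρ' / 2 := by field_simp
    _ < ρ' := by linarith

end Inverse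

end PeelingObservation

end

end Literature.MathematicalPhysics.QuantumFieldTheory.Federbush1986
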